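import Summits.QuantumAdvantage.QuantumAdvantage.Theorems.WbwObfuscatedGluedTreesKowPhPrograms
import Literature.Computability.Cryptography.OracleAdversaryPrecomp
import Literature.Computability.Cryptography.PseudorandomGeneratorsStretchOne
import Literature.Computability.Complexity.CodeFPInvFolds

/-!
# `WbwObfuscatedGluedTrees` (stmt-QuantumAdvantage-2340) — line `knowledge-of-walk-split`, STAGE 7B(b): the
# reparametrisation step of the PRF hybrid (registered stub `reparam_schedPRF`)

Helper file of the PRF hybrid (stage 7) of the line `knowledge-of-walk-split`.  Stage 7 proved the black-box clause
(C) of the landed generator from `SchedPRF Λ P`, the pseudorandomness (`IsPRF`, adversaries polynomial in the SEED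
LENGTH `n`) of the scheduled product ensemble `schedEval Λ P n K (i₀ i₁ x) = F_{kᵢ}(x)` run at the PRF's parameter
`μ = Λ.prfParam n`.  Under the key-length convention `Λ.keyPartLen n = P.keyLen (Λ.prfParam n)` this ensemble is,
pointwise, the re-indexing `n ↦ G (Λ.prfParam n)` of the FOUR-KEY PRODUCT ENSEMBLE
`G m K (i₀ i₁ x) = P.eval m kᵢ x` of `P` at its own parameter `m`.  This file proves the REPARAMETRISATION: if `G` is
pseudorandom against adversaries polynomial in `m`, and the schedule `μ = Λ.prfParam` is computed on unary codes
(`CodeFP unE unE`), strictly increasing and polynomially honest (`n ≤ p(μ(n))`), then `schedEval Λ P` is pseudorandom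
against adversaries polynomial in `n`.  §1–§3 are written for an arbitrary ensemble `G` with
`schedEval Λ P n = G (μ n)`:

* §1 EFFICIENCY of the re-indexed ensemble (compose the schedule on codes with the evaluation machine of `G`,
  `PolyTimeComputable.comp_holds`; polynomial length bounds along `μ(n) ≤ q(n)`);
* §2 the INVERSE SCHEDULE on codes: `m ↦` the number of `j < p(m)` with `μ(j + 1) ≤ m`, a counted loop
  (`CodeFP.iterateInv`, step `(j, c) ↦ (j + 1, c + [μ(j + 1) ≤ m])`) — equal to `n` at `m = μ(n)` by strict
  monotonicity (`invLoop_iterate`);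
* §3 the SECURITY transfer: a PPT distinguisher `𝒜` of `schedEval Λ P` at `n` becomes the PPT distinguisher
  `𝒜.precomp g p` of `G` at `m` ("recover `n` from `m`, run `𝒜` on `1ⁿ`", `OracleAdversary.precomp`), whose real /
  ideal game at `m = μ(n)` IS the real / ideal game of `𝒜` at `n` (`outputPMF_precomp`; the oracles coincide by the
  identification), so the advantages are equal and negligibility in `m` transports to `n` along `n ≤ p(μ(n))`
  (`superpolynomialDecay_of_le_comp`);
* §4 the registered stub (the identification `schedEval Λ P n = G (μ n)` for the product ensemble is by unfolding).

[cite: Goldreich2001, Def. 3.6.4] (the PRF game; the reduction re-indexes the security parameter as in the proof of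
Thm. 3.6.11, Claim 3.6.11.2); AroraBarak2009 §1.3 (bounded loops, composition of polynomial-time maps). [folklore]
-/

set_option linter.dupNamespace false

noncomputable section

namespace Summit.QuantumAdvantage.QuantumAdvantage.Theorems.WbwObfuscatedGluedTrees.KnowledgeOfWalk.PrfHybrid

open Literature.Computability.Complexity Literature.Computability.QuantumComplexity
open Literature.Computability.QuantumComplexity.GluedTrees
open Literature.Computability.Cryptography Literature.Computability.Cryptography.ObfuscatedGluedTrees
open Summit.QuantumAdvantage.QuantumAdvantage.Theorems.WbwObfuscatedGluedTrees.KnowledgeOfWalk.BlackBox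
open Summit.QuantumAdvantage.QuantumAdvantage.Theorems.WbwObfuscatedGluedTrees.KnowledgeOfWalk.RealIdeal
open _root_.Computability
open Literature.Computability.Complexity.CodeFP (unE pairE strE listE bitE natE fst snd const unSucc unLeNat natOfUn
  strLength)
open Filter Asymptotics Polynomial

/-! ## §1 Efficiency of the re-indexed ensemble -/

section Efficiency

variable {Λ : Params} {P : PuncturablePRFScheme} {G : FunctionEnsemble}

/-- A schedule computed on unary codes is polynomially bounded (the output of an `FP` function is polynomially long).
[cite: AroraBarak2009, §1.3] -/
private theorem exists_poly_of_codeFP_unE {g : ℕ → ℕ} (hg : CodeFP unE unE g) : ∃ p : Polynomial ℕ, ∀ n, g n ≤ p.eval n := by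
  -- adapted from `…KowPhOuter.exists_poly_of_codeFP_unE`
  obtain ⟨f, hf, hfg⟩ := hg
  obtain ⟨p, hp⟩ := exists_poly_length_le_of_mem_FP hf
  refine ⟨p, fun n => ?_⟩
  have h := hp (unE n)
  rwa [hfg, CodeFP.length_unE, CodeFP.length_unE] at h

/-- **Efficiency of the re-indexed ensemble**: if `schedEval Λ P n = G (μ n)` pointwise for an efficiently computable
`G` (key length `4·P.keyLen m`, input length `m + 2`, output length `m`) and the schedule `μ` is computed on unary
codes, then `schedEval Λ P` is efficiently computable with key length `4·keyPartLen n = 4·P.keyLen (μ n)`, input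
length `μ n + 2`, output length `μ n`: compose the schedule `1ⁿ ↦ 1^{μ(n)}` on codes with the evaluation machine of
`G`; lengths are bounded along `μ(n) ≤ q(n)`. [cite: Goldreich2001, Def. 3.6.3] -/
private theorem isEfficientFamily_sched (hk : ∀ n, Λ.keyPartLen n = P.keyLen (Λ.prfParam n))
    (hμ : CodeFP unE unE Λ.prfParam) (hGs : ∀ n, schedEval Λ P n = G (Λ.prfParam n))
    (hE : IsEfficientFamily G (fun m => 4 * P.keyLen m) (fun m => m + 2) fun m => m) :
    IsEfficientFamily (schedEval Λ P) (fun n => 4 * Λ.keyPartLen n) (fun n => Λ.prfParam n + 2) Λ.prfParam := by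
  obtain ⟨hpt, ⟨q, hq⟩, hlen⟩ := hE
  obtain ⟨pμ, hpμ⟩ := exists_poly_of_codeFP_unE hμ
  refine ⟨?_, ⟨q.comp pμ + pμ + 2, fun n => ?_⟩, fun n k x hkl hxl => ?_⟩
  · have hR : CodeFP (pairE unE (pairE strE strE)) (pairE unE (pairE strE strE))
        (fun t : ℕ × (List Bool × List Bool) => (Λ.prfParam t.1, t.2)) :=
      (hμ.comp (fst _ _)).pair (snd _ _)
    have hc := PolyTimeComputable.comp_holds hpt hR.polyTimeComputable
    have hfun : (fun t : ℕ × List Bool × List Bool => schedEval Λ P t.1 t.2.1 t.2.2) =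
        (fun t : ℕ × List Bool × List Bool => G t.1 t.2.1 t.2.2) ∘
          (fun t : ℕ × (List Bool × List Bool) => (Λ.prfParam t.1, t.2)) := by
      funext t
      rw [Function.comp_apply, hGs]
    rw [hfun]
    exact hc
  · obtain ⟨h1, -, -⟩ := hq (Λ.prfParam n)
    have hm : q.eval (Λ.prfParam n) ≤ (q.comp pμ).eval n := by
      rw [eval_comp]
      exact TM2Iter.eval_mono q (hpμ n)
    have hp := hpμ n
    beta_reduce at h1 ⊢
    rw [hk n]
    simp only [eval_add, eval_ofNat]
    exact ⟨by omega, by omega, by omega⟩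
  · rw [hGs]
    beta_reduce at hkl
    exact hlen (Λ.prfParam n) k x (by rw [hkl, hk n]) hxl

end Efficiency

/-! ## §2 The inverse schedule on codes -/

section Inverse

/-- A fixed `ℕ`-polynomial in unary: `1ⁿ ↦ 1^{p(n)}` (`Plumb.polyFn`). [cite: AroraBarak2009, §1.3] -/
private theorem unPoly (p : Polynomial ℕ) : CodeFP unE unE (fun n => p.eval n) :=
  ⟨Plumb.polyFn p, Plumb.polyFn_mem_FP p, fun n => by
    rw [Plumb.polyFn_apply, CodeFP.length_unE, CodeFP.unE_eq_ones]⟩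

variable {μ : ℕ → ℕ} {F : ℕ → ℕ × ℕ → ℕ × ℕ}
  (hF : ∀ m b, F m b = (b.1 + 1, if decide (μ (b.1 + 1) ≤ m) then b.2 + 1 else b.2))
include hF

/-- **Semantics of the inversion loop at a value of the schedule**: for the step
`F m (j, c) = (j + 1, c + [μ(j + 1) ≤ m])` and a strictly increasing `μ`, after `B` steps at target `μ(n)` the
counter is `min B n` (the `j` with `μ(j + 1) ≤ μ(n)` are exactly the `j < n`). [folklore] -/
private theorem invLoop_iterate (hmono : StrictMono μ) (n : ℕ) : ∀ B, (F (μ n))^[B] (0, 0) = (B, min B n)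
  | 0 => by simp
  | B + 1 => by
    rw [Function.iterate_succ_apply', invLoop_iterate hmono n B, hF]
    ext
    · rfl
    · simp only [hmono.le_iff_le, decide_eq_true_eq]
      split_ifs <;> omega

/-- The loop invariant (`j` steps taken, counter at most `j`) is preserved by the step. [folklore] -/
private theorem invLoop_inv (m j : ℕ) (b : ℕ × ℕ) (h : b.1 = j ∧ b.2 ≤ j) : (F m b).1 = j + 1 ∧ (F m b).2 ≤ j + 1 := by
  obtain ⟨h1, h2⟩ := h
  rw [hF]
  refine ⟨by rw [h1], ?_⟩
  dsimp only
  split_ifs <;> omega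

/-- The counter never exceeds the number of steps. [folklore] -/
private theorem invLoop_iterate_snd_le (m B : ℕ) : ((F m)^[B] (0, 0)).2 ≤ B :=
  (CodeFP.iterate_inv_holds (F := F) (init := fun _ => ((0 : ℕ), (0 : ℕ))) (fun _ j b => b.1 = j ∧ b.2 ≤ j)
    (fun _ => ⟨rfl, le_rfl⟩) (fun m j b h => invLoop_inv hF m j b h) m B).2

/-- The loop step on codes (the schedule on codes, a unary comparison, a branch). [cite: AroraBarak2009, §1.3] -/
private theorem codeFP_invLoop (hμ : CodeFP unE unE μ) :
    CodeFP (pairE unE (pairE unE unE)) (pairE unE unE) (fun t => F t.1 t.2) := by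
  have hj : CodeFP (pairE unE (pairE unE unE)) unE (fun t => t.2.1 + 1) := unSucc.comp (snd _ _).fst'
  have hc : CodeFP (pairE unE (pairE unE unE)) unE (fun t => t.2.2) := (snd _ _).snd'
  have ht : CodeFP (pairE unE (pairE unE unE)) bitE (fun t => decide (μ (t.2.1 + 1) ≤ t.1)) :=
    unLeNat.comp ((hμ.comp hj).pair (natOfUn.comp (fst _ _)))
  exact (hj.pair (ht.ite (unSucc.comp hc) hc)).congr fun t => (hF t.1 t.2).symm

/-- **The inverse schedule on codes**: `m ↦` the counter after `p(m)` loop steps at target `m`, a counted loop with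
a linear size invariant (`CodeFP.iterateInv`). [cite: AroraBarak2009, §1.3] -/
private theorem codeFP_inv (hμ : CodeFP unE unE μ) (p : Polynomial ℕ) :
    CodeFP unE unE (fun m => ((F m)^[p.eval m] (0, 0)).2) := by
  have h := CodeFP.iterateInv (eσ := unE) (eβ := pairE unE unE) (F := F)
    (init := fun _ => ((0 : ℕ), (0 : ℕ))) (k := fun m => p.eval m) (fun _ j b => b.1 = j ∧ b.2 ≤ j)
    (codeFP_invLoop hF hμ) (const unE ((0 : ℕ), (0 : ℕ))) (unPoly p) (fun _ => ⟨rfl, le_rfl⟩)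
    (fun m j b h => invLoop_inv hF m j b h) (3 * X + 2) (fun s j b h => by
      rw [CodeFP.length_pairE, CodeFP.length_unE, CodeFP.length_unE]
      simp only [eval_add, eval_mul, eval_ofNat, eval_X]
      omega)
  exact h.snd'

omit hF in
/-- **The preprocessing map**: a polynomial-time string map `g` with `|g w| ≤ p(|w|)` which sends `1^{μ(n)}` to
`1ⁿ` (for `μ` strictly increasing, computed on codes, with `n ≤ p(μ(n))`): `w ↦ 1^{c}`, `c` the counter of the
inversion loop run `p(|w|)` times at target `|w|`. [cite: AroraBarak2009, §1.3] -/
private theorem exists_preproc (hμ : CodeFP unE unE μ) (hmono : StrictMono μ) (p : Polynomial ℕ)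
    (hp : ∀ n, n ≤ p.eval (μ n)) :
    ∃ g : List Bool → List Bool, g ∈ FP ∧ (∀ w, (g w).length ≤ p.eval w.length) ∧
      ∀ n, g (unaryEncodeNat (μ n)) = unaryEncodeNat n := by
  have hF : ∀ (m : ℕ) (b : ℕ × ℕ),
      (fun (m : ℕ) (b : ℕ × ℕ) => (b.1 + 1, if decide (μ (b.1 + 1) ≤ m) then b.2 + 1 else b.2)) m b =
        (b.1 + 1, if decide (μ (b.1 + 1) ≤ m) then b.2 + 1 else b.2) := fun _ _ => rfl
  obtain ⟨f, hf, hfv⟩ := (codeFP_inv hF hμ p).comp strLength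
  refine ⟨f, hf, fun w => ?_, fun n => ?_⟩
  · rw [show f w = _ from hfv w, CodeFP.length_unE]
    exact invLoop_iterate_snd_le hF _ _
  · rw [show f (unaryEncodeNat (μ n)) = _ from hfv _]
    beta_reduce
    rw [CodeFP.length_unE, invLoop_iterate hF hmono n, min_eq_right (hp n)]

end Inverse

/-! ## §3 The games of the preprocessing adversary at `μ(n)` are the games of `𝒜` at `n` -/

section Games

variable {Λ : Params} {P : PuncturablePRFScheme} {G : FunctionEnsemble} (𝒜 : OracleAdversary Bool)
  {g : List Bool → List Bool} {s : Polynomial ℕ}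

/-- **Real games agree** at `m = μ(n)`: same key law (`4·keyPartLen n = 4·P.keyLen (μ n)` bits), same oracle (the
identification `schedEval Λ P n = G (μ n)`), and the preprocessing adversary on `1^m` runs `𝒜` on `g (1^m) = 1ⁿ`.
[cite: Goldreich2001, Def. 3.6.4] -/
private theorem prfRealPMF_sched (hk : ∀ n, Λ.keyPartLen n = P.keyLen (Λ.prfParam n))
    (hGs : ∀ n, schedEval Λ P n = G (Λ.prfParam n)) (hs : ∀ w, (g w).length ≤ s.eval w.length) {n : ℕ}
    (hg : g (unaryEncodeNat (Λ.prfParam n)) = unaryEncodeNat n) :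
    prfRealPMF G (fun m => 4 * P.keyLen m) (fun m => m + 2) (𝒜.precomp g s) (Λ.prfParam n) =
      prfRealPMF (schedEval Λ P) (fun n => 4 * Λ.keyPartLen n) (fun n => Λ.prfParam n + 2) 𝒜 n := by
  simp only [prfRealPMF]
  rw [hk n, hGs n]
  refine congrArg _ (funext fun k => ?_)
  rw [OracleAdversary.outputPMF_precomp _ hs, hg]

omit P in
/-- **Ideal games agree** at `m = μ(n)`: the same uniformly random function `{0,1}^{m+2} → {0,1}^m`, and the
preprocessing adversary on `1^m` runs `𝒜` on `1ⁿ`. [cite: Goldreich2001, Def. 3.6.4] -/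
private theorem prfIdealPMF_sched (hs : ∀ w, (g w).length ≤ s.eval w.length) {n : ℕ}
    (hg : g (unaryEncodeNat (Λ.prfParam n)) = unaryEncodeNat n) :
    prfIdealPMF (fun m => m + 2) (fun m => m) (𝒜.precomp g s) (Λ.prfParam n) =
      prfIdealPMF (fun n => Λ.prfParam n + 2) Λ.prfParam 𝒜 n := by
  simp only [prfIdealPMF]
  refine congrArg _ (funext fun H => ?_)
  rw [OracleAdversary.outputPMF_precomp _ hs, hg]

/-- **The advantages are equal**: the advantage of `𝒜` against the scheduled ensemble at `n` is the advantage of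
the preprocessing adversary against `G` at `μ(n)`. [cite: Goldreich2001, Def. 3.6.4] -/
private theorem prfAdvantage_sched (hk : ∀ n, Λ.keyPartLen n = P.keyLen (Λ.prfParam n))
    (hGs : ∀ n, schedEval Λ P n = G (Λ.prfParam n)) (hs : ∀ w, (g w).length ≤ s.eval w.length) {n : ℕ}
    (hg : g (unaryEncodeNat (Λ.prfParam n)) = unaryEncodeNat n) :
    prfAdvantage (schedEval Λ P) (fun n => 4 * Λ.keyPartLen n) (fun n => Λ.prfParam n + 2) Λ.prfParam 𝒜 n =
      prfAdvantage G (fun m => 4 * P.keyLen m) (fun m => m + 2) (fun m => m) (𝒜.precomp g s) (Λ.prfParam n) := by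
  simp only [prfAdvantage, prfRealProb, prfIdealProb, prfRealPMF_sched 𝒜 hk hGs hs hg, prfIdealPMF_sched 𝒜 hs hg]

end Games

/-! ## §4 The transfer and the registered stub -/

/-- **Pseudorandomness transfers along the schedule**: if `schedEval Λ P n = G (μ n)` pointwise for a pseudorandom
`G` (adversaries polynomial in `m`; key length `4·P.keyLen m`, input length `m + 2`, output length `m`), the
key-length convention holds and `μ` is computed on unary codes, strictly increasing and polynomially honest, then
`SchedPRF Λ P`: efficiency by `isEfficientFamily_sched`; a PPT distinguisher `𝒜` at `n` yields the PPT distinguisher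
`𝒜.precomp g p` of `G` with the same advantage at `μ(n)` (`prfAdvantage_sched`), negligible in `μ(n)`, hence in `n`
(`superpolynomialDecay_of_le_comp` along `n ≤ p(μ(n))`). [cite: Goldreich2001, Def. 3.6.4] -/
private theorem schedPRF_of_isPRF {Λ : Params} {P : PuncturablePRFScheme} {G : FunctionEnsemble}
    (hk : ∀ n, Λ.keyPartLen n = P.keyLen (Λ.prfParam n)) (hμ : CodeFP unE unE Λ.prfParam)
    (hmono : StrictMono Λ.prfParam) (p : Polynomial ℕ) (hp : ∀ n, n ≤ p.eval (Λ.prfParam n))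
    (hGs : ∀ n, schedEval Λ P n = G (Λ.prfParam n))
    (hG : IsPRF G (fun m => 4 * P.keyLen m) (fun m => m + 2) fun m => m) : SchedPRF Λ P := by
  refine ⟨isEfficientFamily_sched hk hμ hGs hG.1, fun 𝒜 h𝒜 => ?_⟩
  obtain ⟨g, hgFP, hgs, hgv⟩ := exists_preproc hμ hmono p hp
  refine superpolynomialDecay_of_le_comp (τ := Λ.prfParam) p
    (hG.2 (𝒜.precomp g p) (OracleAdversary.isPPT_precomp 𝒜 encodingBoolBool hgFP h𝒜 p)) hp fun n => ?_
  rw [prfAdvantage_sched 𝒜 hk hGs hgs (hgv n)]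

/-- **Stub (reparametrisation of the PRF hybrid, stage 7B(b))**: pseudorandomness of the four-key product
ensemble of `P` at its own parameter `m` (adversaries polynomial in `m`) gives pseudorandomness of the scheduled
product ensemble `schedEval Λ P` (adversaries polynomial in the seed length `n`), provided the key-length convention
`keyPartLen n = P.keyLen (μ n)` holds and the schedule `μ = Λ.prfParam` is computed on unary codes, strictly
increasing and polynomially honest (`n ≤ p(μ(n))`).  The identification `schedEval Λ P n = G (μ n)` with the
product ensemble is by unfolding `schedEval` / `Params.key`; then `schedPRF_of_isPRF`. [cite: Goldreich2001, Def. 3.6.4] -/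
theorem reparam_schedPRF :
    ∀ (Λ : Params) (P : PuncturablePRFScheme), (∀ n, Λ.keyPartLen n = P.keyLen (Λ.prfParam n)) →
      CodeFP unE unE Λ.prfParam → StrictMono Λ.prfParam → (∃ p : Polynomial ℕ, ∀ n, n ≤ p.eval (Λ.prfParam n)) →
      IsPRF (fun m K z => P.eval m ((K.drop ((keyIdx z).val * P.keyLen m)).take (P.keyLen m)) (z.drop 2))
        (fun m => 4 * P.keyLen m) (fun m => m + 2) (fun m => m) →
      SchedPRF Λ P :=
  fun _ _ hk hμ hmono hp hG => hp.elim fun p hp =>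
    schedPRF_of_isPRF hk hμ hmono p hp (fun n => by funext K z; simp only [schedEval, Params.key, hk]) hG

end Summit.QuantumAdvantage.QuantumAdvantage.Theorems.WbwObfuscatedGluedTrees.KnowledgeOfWalk.PrfHybrid

end
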